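import Mathlib
import HarnessLib
import HarnessLib.Audit
import Summits.Parity.Statement
import Literature.NumberTheory.Sieve.PolymathBoundedGaps
import Literature.NumberTheory.Sieve.PolymathMkEpsDilation
import HarnessLib.Audit.Status.Attr

/-!
Route: PolymathEpsThreeCeiling

CLOSED (proved) 2026-08-31T14:30:02Z by operator:999:1433239 — reason: proved:Summit.Parity.GeneralizedHardyLittlewood.Theses.PolymathEpsThreeCeiling.epsThreeLeTwo_proof — note: success close on decomp-parity-writer-1 g23 CLOSE-VERB ASK (REQUESTS l.67486 (1b)): target stmt-Parity-19068 closed·proved p823658; route rev 1 finish ALL PROVED; programme route, zero summit credit; operator priority29. The file is kept as the record of this route; refuted decls are indexed as negative knowledge (`ledger negatives`).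

# Route PolymathEpsThreeCeiling — M_{3,ε} ≤ 2 on [0,1/2] by 24 exact Collatz–Wielandt certificates
chained by dilation

RUNG ROUTE (D-0059/D-0061, class rung; closes the rung leaf
`Summit.Parity.GeneralizedHardyLittlewood.EpsFunctionalThreeLeTwo := MkEps.EpsFunctionalLe 3 (1/2)
2`: for every
ε ∈ [0, 1/2] and every test function F of Polymath 8b Theorem 3.12 on (1+ε)·R₃, (Σᵢ
J_{i,1−ε}(F))/I(F) ≤ 2 — i.e. the GEH criterion
of Theorem 3.12 (ii) is met by NO test function at k = 3; never summit credit). It suffices to show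
X = X1 ∧ X2, the GRID BOUNDS
M_{3, j/80} ≤ 2(80+j)/(81+j): X1 (GridBoundHigh) for 17 ≤ j ≤ 40 — the 24 exact-rational
Collatz–Wielandt certificates of the cell —
and X2 (GridBoundLow) for j ≤ 16 — from the tree's completed Proposition 6.5 at ε = 0 transported by
(1+ε). The landed dilation chain
`MkEps.dilationChain_holds` (leaf B) then covers [j/80, (j+1)/80] from the bound at j/80 with the
factor (81+j)/(80+j). No idea card is
realised (cell parity-ideate instrument line, ROUND-1 §D).
Lean: `(∀ j : ℕ, 17 ≤ j → j ≤ 40 → ∀ ⦃F : (Fin 3 → ℝ) → ℝ⦄,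
Literature.NumberTheory.Sieve.IsPolymathTestFunction 3 ((j : ℝ) / 80) F →
Literature.NumberTheory.Sieve.polymathFunctional 3 ((j : ℝ) / 80) F ≤ 2 * (80 + j) / (81 + j)) ∧ (∀
j : ℕ, j ≤ 16 → ∀ ⦃F : (Fin 3 → ℝ) → ℝ⦄, Literature.NumberTheory.Sieve.IsPolymathTestFunction 3 ((j
: ℝ) / 80) F → Literature.NumberTheory.Sieve.polymathFunctional 3 ((j : ℝ) / 80) F ≤ 2 * (80 + j) /
(81 + j))`

## Assembly
Given ε ∈ [0,1/2] and a test function F, put j = ⌊80ε⌋ ≤ 40; `MkEps.dilationChain_holds` (leaf B,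
PROVED) with (ε₀, ε') = (j/80, ε)
makes the dilate F∘(λ•), λ = (1+ε)/(1+j/80), a j/80-test function and bounds functional(ε, F) ≤ λ ·
functional(j/80, dilate)
≤ λ · 2(80+j)/(81+j) = 160(1+ε)/(81+j) ≤ 2 because 80ε ≤ j+1. That 35-line argument is the ASSEMBLY
item (PROVED:
`assembly_holds`/`closes` in SketchM2.lean and bc/glueM_test.lean, rc 0, std axioms) and the
deciding theorem is
`closes (hA : Assembly) (hH : GridBoundHigh) (hL : GridBoundLow) : EpsThreeLeTwo := hA hH hL`
(glue.lean), so that every declared item is in the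
cone of `closes` (BC6). Until the target is registered as ALT-CLOSER the gate reads this as
conclusion-mismatch and the route is DRAFT by design;
`ledger route edit <id> --closes-target <registered FQN> --closes-file glue.lean` then serves it.

CLOSES_TARGET: closes rung F-P1 of Parity: Summit.Parity.GeneralizedHardyLittlewood.Theses.PolymathEpsThreeCeiling.EpsThreeLeTwo (D-0061; not the summit Statement) — the deciding theorem of this route concludes that registered leaf instead of the Statement decl `GeneralizedHardyLittlewood` (class rung: servable and labelled, never counted as concluding the summit Statement).

Rationale: WHY THIS LINE. Polymath 8b (arXiv:1407.4897) proved GEH ⇒ H₁ ≤ 6 through the vanishing-marginal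
relaxation (Theorems 3.14/3.15) after recording only
1.91726 ≤ M_{3,ε} (Remark 7.4, ε = 56/113) against the threshold 2 of Theorem 3.12 (ii); whether the
plain ε-enlarged functional already
fails at k = 3 is not decided in print (upper bound in print: Proposition 6.5, M_{3,ε} ≤ (3/2) log 5
= 2.41; Broughan 2021 Thm 7.17).
The cell settled it numerically-exactly: M_{3,ε} ≤ 2 on all of [0,1/2] (41 certificates, kit
j240695/j240969; worst chain product
1.98928). Mechanism: the tree's PROVED weighted Cauchy–Schwarz duality
`polymathFunctional_le_of_weights` (any positive weight system
with unit fibre budgets bounds the functional by the sup of the pointwise sum) turns each grid bound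
into a finite inequality system for
piecewise-constant weights w_m = r_m/P(c) read off a Perron vector; the dilation identities (Remark
6.6's limiting case, proved in leaf B)
interpolate between grid points. Imported area: Collatz–Wielandt / Perron–Frobenius duality and
exact rational certification (numerical
linear algebra) pointed at a sieve-theoretic variational problem.

RANKED CRUXES. #0 EpsThreeLeTwo (target) — the rung leaf itself, as this route's target item:
M_{3,ε} ≤ 2 for every ε ∈ [0, 1/2] (Polymath 8b Theorem 3.13's functional, the GEH(k=3) ceiling) —
identical by `rfl` to the operator leaf
`Summit.Parity.GeneralizedHardyLittlewood.EpsFunctionalThreeLeTwo` if/when that is landed;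
registered (or to be registered) as the rung's ALT-CLOSER (D-0061). (why it might fail: it is a rung
leaf decided by this route's two grid bounds; it fails only if one of the 24 high-ε certificates is
wrong (min slack 0.0094 at j = 40).) [Polymath8b2014, arXiv:1407.4897]
#2 GridBoundHigh (crux) — for every integer 17 ≤ j ≤ 40 and every test function F of Theorem 3.12 at
ε = j/80 (k = 3), (Σᵢ J_{i,1−ε}(F))/I(F) ≤ 2(80+j)/(81+j) — 24 instances of
`polymathFunctional_le_of_weights` with cell-constant weights on the grid h = 1/80 (certified values
1.91816 … 1.97407, slack ≥ 0.0094 against the stated constants; ROUND-1 §D.3/D.6, kit j240695).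
[difficulty: L] (why it might fail: the kernel replay needs the fibre-budget hypothesis `hbudget`
for CELL-constant weights EXACTLY (half-open cell convention at fibre ends, Σs ≥ hΣc_j rounding); an
off-by-one-cell error in the certificate format would eat the 0.0094 slack at j = 40 (cert 1.97407
vs 1.98347).) [Polymath8b2014, arXiv:1407.4897]
#3 GridBoundLow (crux) — for every integer j ≤ 16 and every test function F at ε = j/80 (k = 3), (Σᵢ
J_{i,1−ε}(F))/I(F) ≤ 2(80+j)/(81+j) — from M_{3,0} ≤ (3/2) log 3 (`polymathFunctional_le_epsT` at ε
= 0, τ = 1, in the tree) transported by `MkEps.bound_of_eps_zero` (factor 1+ε) and log 3 < 1.0987 (j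
= 16: 1.97766 ≤ 1.97938). [difficulty: provable-now] (why it might fail: it cannot — PROVED by this
seat (`gridBoundLow_holds`, bc/GridBoundLow_holds.lean, farm rc 0, 0 sorries, std axioms; log 3 <
1.0988 via Mathlib log 2 bound + Taylor remainder at 1/4); kept at rank 3 only for the crux floor —
the rung is ONE certificate after the proved reductions.) [Polymath8b2014, arXiv:1407.4897]

TWO-LAYER PLAN. TYPED AND GLUED ALREADY (bc/GridBoundHigh_birth.lean, rc 0, sorry only in the
certificate stub): GridBoundHigh ⇐ CWCertsHigh :=
`∀ j, 17 ≤ j → j ≤ 40 → CWCertAt (j/80) (2(80+j)/(81+j))`, where `CWCertAt ε M := ∃ w : Fin 3 → (Fin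
3 → ℝ) → ℝ` (measurable, positive on
{t_m > 0, Σ_{i≠m} tᵢ ≤ 1−ε}, fibre budgets `∫⁻_{(0,1+ε−Σs]} (w m (insertNth m u s))⁻¹ ≤ 1`,
pointwise `Σ_m 1[…]·w m t ≤ M` on {t ≥ 0, Σ t ≤ 1+ε})
is exactly the F-INDEPENDENT data of the tree's PROVED checker `polymathFunctional_le_of_weights`
(Polymath 8b Lemma 6.1, ε-enlarged); the glue
`gridBoundHigh_of_cwCertsHigh : CWCertsHigh → GridBoundHigh` is proved (std axioms). Under
CWCertsHigh the prover's layer (lemmas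
`--supports GridBoundHigh`, never items): CWSchemaSound (piecewise-constant weights on the cell's
rational grid: cells c, multiplicities P(c),
Perron entries r_m(c), bounds U(c) satisfying finitely many rational inequalities ⇒
measurability/hpos/hbudget/hpt) and CWTablesHigh (the 24 tables
of kit j240695 pass with max U ≤ 2(80+j)/(81+j), ≤ 2.1·10⁵ cells each, `decide`/`norm_num`-sized).
GridBoundLow is PROVED (no split).

KILL CRITERIA. A test function F at some ε ≤ 1/2 with functional > 2 (e.g. a finer Polymath-style
lower-bound optimisation beating 2 — print has 1.91726)
refutes the leaf and the certificate at the neighbouring grid point: close `refuted:GridBoundHigh`.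
An independent exact re-run of
cw_cert.py disagreeing with a logged rational kills that grid point only — re-certify at finer h (h
= 1/160, 1/240 runs exist at ε = 1/2:
1.95963, 1.95498) and restate the constant. If Mathlib cannot deliver log 3 < 1.0987 cheaply, move j
= 15, 16 into GridBoundHigh (pivot,
not death).

NOT DECOMPOSED YET. The certificate schema (cell geometry on the h-grid, the half-open convention,
the table datatype) and the per-j tables are layer-2
children of GridBoundHigh; the identification `polymathFunctional_le_epsT (n := 2) (ε := 0) (τ :=
1)` = (3/2) log 3 (the two `max 0 (min 0 _ - 0)`
summands vanish) is routine inside GridBoundLow.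

CHEAPEST FALSIFIER. Exact re-verification of the chain from the logged rationals: `python3
evidence/chain_check.py evidence/j240695-chain-stdout.log
evidence/j240969-chain0-stdout.log` (seconds; DONE by g0: CHAIN VERDICT CERTIFIED, worst 1.989284)
and the constants of this route (DONE
2026-08-25 by g2: cert_j ≤ 2(80+j)/(81+j) for all 17 ≤ j ≤ 40, min slack 0.0094 at j = 40;
(1+j/80)(3/2)(1.0987) ≤ 2(80+j)/(81+j) for all
j ≤ 16). Next cheapest: one independent CW certificate at ε = 1/2 with a different cell convention
(kit, 30 s) must again give ≤ 1.975.

NUMBERS. Threshold 2 = 2m/θ (m = 1, θ = 1 under GEH; ε < 1/(k−1) = 1/2 at k = 3). Print: 1.91726 ≤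
M_{3,56/113} (Polymath8b2014 Remark 7.4);
M_{k,ε} ≤ (k/(k−1)) log(2k−1) = 2.414 at k = 3 (Prop. 6.5; tree `polymathFunctional_le_log`); M_3 ≤
(3/2) log 3 = 1.64792 (Cor. 6.4; tree
`polymathFunctional_le_epsT`). Cell: certified M_{3,ε_j} ≤ 1.91050 (j=16) … 1.97407 (j=40) at h =
1/80; 1.95963 (h=1/160), 1.95498 (h=1/240)
at ε = 1/2; chain worst 1.98928. Items at open: 3 (GridBoundHigh = the certificate; GridBoundLow
PROVED, kept as rank-3 item for the crux floor; assembly).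

DEFINITION REQUESTS. None new: IsPolymathTestFunction / polymathFunctional exist; the statement
layer `MkEps.EpsFunctionalLe` and the PROVED dilation chain
`MkEps.dilationChain_holds` / `chain_link` / `bound_of_eps_zero` LANDED as p405742
(Literature/NumberTheory/Sieve/PolymathMkEpsDilation.lean,
2026-08-25). ALT-CLOSER (D-0061, class rung, rung F-P1) — either of two registrations serves this
route: (i) register THIS route's target decl
`Summit.Parity.GeneralizedHardyLittlewood.Theses.PolymathEpsThreeCeiling.EpsThreeLeTwo` (precedents:
Hodge H1/H2, YangMills R2a–d point at Theses decls; no file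
landing needed), then `ledger route edit <id> --closes-target <that FQN> --closes-file glue.lean`;
or (ii) land the operator leaf
`Summit.Parity.GeneralizedHardyLittlewood.EpsFunctionalThreeLeTwo` (text
HOME/parity-ideate-lit/leaves/EpsFunctionalThreeLeTwo.lean, same body by `rfl`) and register it,
then the same edit with a glue ending `:= by unfold
Summit.Parity.GeneralizedHardyLittlewood.EpsFunctionalThreeLeTwo; exact hA …` and the target item
retriaged `aside`. The route is opened DRAFT before either (conclusion-mismatch by design).

Novelty: Searches (2026-08-25): `lit search --hybrid "Polymath variants of Selberg sieve M_k epsilon enlarged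
simplex GEH upper bound for the functional" -n 8` (8 books; relevant: Broughan, Bounded Gaps Between
Primes, §7.9–7.10) [corpus:book:broughannd-bounded-gaps-between-primes p.238, Thm 7.17 = Prop 6.5
only]; `lit vsearch "upper bound for the Maynard-Tao sieve functional M_{k,epsilon} … k=3" -k 8` (no
relevant hit beyond Cojocaru–Murty); `lit galaxy search "M_{k,\epsilon}|epsilon-trick|enlarged
simplex" --star pdf -n 8` (8 rows, none relevant) — no hits for the k = 3 ceiling in corpus(fts+vec)
and galaxy; `lit search "Maynard Tao sieve GEH bounded gaps 6 optimal" --source all --year-from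
2015` (crossref: Broughan ch. "Polymath's refinements", Maynard 2015; openalex/s2 rate-limited);
`ledger negatives --problem Parity` (4, none related).
Nearest prior art found: Polymath8b2014 (arXiv:1407.4897) Remark 7.4 (1.91726 ≤ M_{3,ε}) and
Proposition 6.5 / Broughan Thm 7.17 (M_{3,ε} ≤ 2.414) — the value of sup_ε M_{3,ε} relative to 2 is
left open there; the tree's barrier file `MaynardFunctionalCeiling` records M_k-ceilings, not the
ε-version at k = 3.
Delta: decides the k = 3 GEH cell of Theorem 3.12 (ii) negatively (M_{3,ε} ≤ 2 on [0,1/2]) by exact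
Collatz–Wielandt certificates for the tree's weighted Cauchy–Schwarz duality plus a proved dilation
chain — a certified-computation closure of a question print left numerically open.
Claimed grade: variant  [refs: 1407.4897, book:broughannd-bounded-gaps-between-primes]

Barriers (technique_class: certified-computation, sieve-functional-duality): - technique_class: certified-computation, sieve-functional-duality
- Literature.Barriers.Parity.MaynardFunctionalCeiling: the route EXTENDS this barrier family (it is
itself a ceiling statement: the ε-trick cannot reach H₁ ≤ 6 at k = 3 without vanishing marginals);
nothing to evade.
- Literature.Barriers.Parity.SelbergParityBarrier: consistent — a limitation result for a sieve
functional, not a prime-producing claim.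
- Negatives index: empty near this line at filing (4 Parity negatives, none about
polymathFunctional).

History (route lifecycle, newest last):
- 2026-08-26T01:28:32Z · closes_target -> closes rung F-P1 of Parity: Summit.Parity.GeneralizedHardyLittlewood.Theses.PolymathEpsThreeCeiling.EpsThreeLeTwo (D-0061; not the summit Statement) (planner-parity-ideate-p3-g4-0)
- 2026-08-31T14:30:02Z · CLOSED proved — proved:Summit.Parity.GeneralizedHardyLittlewood.Theses.PolymathEpsThreeCeiling.epsThreeLeTwo_proof (operator:999:1433239)

sub-problem: GeneralizedHardyLittlewood · status: closed(proved) · opened planner-parity-ideate-p3-g2-0 2026-08-25T21:09:15Z · rev 1 · ledger route-Parity-PolymathEpsThreeCeiling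
GENERATED by the gate from the ledger (D-0016/17). Provers cite these decls: `theorem foo : Summit.Parity.GeneralizedHardyLittlewood.Theses.PolymathEpsThreeCeiling.<Decl> := …` in Summits/Parity/GeneralizedHardyLittlewood/Theorems/<Name>.lean.
-/

namespace Summit.Parity.GeneralizedHardyLittlewood.Theses.PolymathEpsThreeCeiling

open scoped BigOperators Topology Manifold Classical MeasureTheory ProbabilityTheory Matrix InnerProductSpace ComplexConjugate ContinuousMap
open Filter Set Function TopologicalSpace MeasureTheory

attribute [summit_statement] _root_.GeneralizedHardyLittlewood
-- H21.Audit: the closer leaf Summit.Parity.GeneralizedHardyLittlewood.Theses.PolymathEpsThreeCeiling.EpsThreeLeTwo is an item decl of this route file — tagged summit_statement below, after its declaration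

/-- item stmt-Parity-19068 · target · rank 0 · closed · proved by Summit.Parity.GeneralizedHardyLittlewood.Theses.PolymathEpsThreeCeiling.epsThreeLeTwo_proof (prover) · by planner
why it might fail: it is a rung leaf decided by this route's two grid bounds; it fails only if one of the 24 high-ε certificates is wrong (min slack 0.0094 at j = 40).
sources: Polymath8b2014, arXiv:1407.4897
[target] the rung leaf itself, as this route's target item: M_{3,ε} ≤ 2 for every ε ∈ [0, 1/2]
(Polymath 8b Theorem 3.13's functional, the GEH(k=3) ceiling) — identical by `rfl` to the operator
leaf `Summit.Parity.GeneralizedHardyLittlewood.EpsFunctionalThreeLeTwo` if/when that is landed;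
registered (or to be registered) as the rung's ALT-CLOSER (D-0061). -/
@[route_item "route-Parity-PolymathEpsThreeCeiling"]
def EpsThreeLeTwo : Prop :=
  Literature.NumberTheory.Sieve.MkEps.EpsFunctionalLe 3 (1 / 2) 2

-- `EpsThreeLeTwo` holds: proved by `Summit.Parity.GeneralizedHardyLittlewood.Theses.PolymathEpsThreeCeiling.epsThreeLeTwo_proof` (its module imports this route file, so no `_holds` link can be stated here).

/-- item stmt-Parity-19069 · crux · rank 2 · closed · proved by Summit.Parity.GeneralizedHardyLittlewood.Theses.PolymathEpsThreeCeiling.gridBoundHigh_proof (prover) · by planner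
why it might fail: the kernel replay needs the fibre-budget hypothesis `hbudget` for CELL-constant weights EXACTLY (half-open cell convention at fibre ends, Σs ≥ hΣc_j rounding); an off-by-one-cell error in the certificate format would eat the 0.0094 slack at j = 40 (cert 1.97407 vs 1.98347).
sources: Polymath8b2014, arXiv:1407.4897
[crux] for every integer 17 ≤ j ≤ 40 and every test function F of Theorem 3.12 at ε = j/80 (k = 3),
(Σᵢ J_{i,1−ε}(F))/I(F) ≤ 2(80+j)/(81+j) — 24 instances of `polymathFunctional_le_of_weights` with
cell-constant weights on the grid h = 1/80 (certified values 1.91816 … 1.97407, slack ≥ 0.0094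
against the stated constants; ROUND-1 §D.3/D.6, kit j240695). [difficulty: L] -/
@[route_item "route-Parity-PolymathEpsThreeCeiling", crux]
def GridBoundHigh : Prop :=
  ∀ j : ℕ, 17 ≤ j → j ≤ 40 → ∀ ⦃F : (Fin 3 → ℝ) → ℝ⦄, Literature.NumberTheory.Sieve.IsPolymathTestFunction 3 ((j : ℝ) / 80) F → Literature.NumberTheory.Sieve.polymathFunctional 3 ((j : ℝ) / 80) F ≤ 2 * (80 + j) / (81 + j)

-- `GridBoundHigh` holds: proved by `Summit.Parity.GeneralizedHardyLittlewood.Theses.PolymathEpsThreeCeiling.gridBoundHigh_proof` (its module imports this route file, so no `_holds` link can be stated here).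

/-- item stmt-Parity-19070 · crux · rank 3 · closed · proved by Summit.Parity.GeneralizedHardyLittlewood.Theses.PolymathEpsThreeCeiling.gridBoundLow_holds (prover) · by planner
why it might fail: it cannot — PROVED by this seat (`gridBoundLow_holds`, bc/GridBoundLow_holds.lean, farm rc 0, 0 sorries, std axioms; log 3 < 1.0988 via Mathlib log 2 bound + Taylor remainder at 1/4); kept at rank 3 only for the crux floor — the rung is ONE certificate after the proved reductions.
sources: Polymath8b2014, arXiv:1407.4897
[crux] for every integer j ≤ 16 and every test function F at ε = j/80 (k = 3), (Σᵢ
J_{i,1−ε}(F))/I(F) ≤ 2(80+j)/(81+j) — from M_{3,0} ≤ (3/2) log 3 (`polymathFunctional_le_epsT` at ε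
= 0, τ = 1, in the tree) transported by `MkEps.bound_of_eps_zero` (factor 1+ε) and log 3 < 1.0987 (j
= 16: 1.97766 ≤ 1.97938). [difficulty: provable-now] -/
@[route_item "route-Parity-PolymathEpsThreeCeiling", crux]
def GridBoundLow : Prop :=
  ∀ j : ℕ, j ≤ 16 → ∀ ⦃F : (Fin 3 → ℝ) → ℝ⦄, Literature.NumberTheory.Sieve.IsPolymathTestFunction 3 ((j : ℝ) / 80) F → Literature.NumberTheory.Sieve.polymathFunctional 3 ((j : ℝ) / 80) F ≤ 2 * (80 + j) / (81 + j)

-- `GridBoundLow` holds: proved by `Summit.Parity.GeneralizedHardyLittlewood.Theses.PolymathEpsThreeCeiling.gridBoundLow_holds` (its module imports this route file, so no `_holds` link can be stated here).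

/-- item stmt-Parity-19071 · assembly · rank 1 · closed · proved by Summit.Parity.GeneralizedHardyLittlewood.Theses.PolymathEpsThreeCeiling.assembly_holds (prover) · by planner
sources: Polymath8b2014
[assembly] GridBoundHigh → GridBoundLow → EpsFunctionalThreeLeTwo. -/
@[route_item "route-Parity-PolymathEpsThreeCeiling", crux]
def Assembly : Prop :=
  GridBoundHigh → GridBoundLow → EpsThreeLeTwo

-- `Assembly` holds: proved by `Summit.Parity.GeneralizedHardyLittlewood.Theses.PolymathEpsThreeCeiling.assembly_holds` (its module imports this route file, so no `_holds` link can be stated here).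

attribute [summit_statement] _root_.Summit.Parity.GeneralizedHardyLittlewood.Theses.PolymathEpsThreeCeiling.EpsThreeLeTwo

/-! D-0027 §2.1 — DECIDING THEOREM (planner-authored via `route open/edit --closes-file`; by planner-parity-ideate-p3-g4-0 2026-08-26T01:28:32Z) — ARCHIVED: route closed (proved) 2026-08-31T14:30:02Z; kept so importers keep building:
its hypotheses are this route's items and its conclusion the registered leaf `Summit.Parity.GeneralizedHardyLittlewood.Theses.PolymathEpsThreeCeiling.EpsThreeLeTwo` (rung F-P1, D-0061) (glue_lint), and it elaborates with this file. -/

@[closes "route-Parity-PolymathEpsThreeCeiling"] theorem closes (hA : Assembly) (hH : GridBoundHigh) (hL : GridBoundLow) : EpsThreeLeTwo := hA hH hL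

end Summit.Parity.GeneralizedHardyLittlewood.Theses.PolymathEpsThreeCeiling
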